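import Literature.Topology.FourManifolds.BoundaryGluingVanKampen
import Literature.Topology.FourManifolds.CollarTheorem
import Literature.AlgebraicTopology.FundamentalGroup.CellAttachment
import Literature.AlgebraicTopology.FundamentalGroup.VanKampenPushout
import Mathlib.AlgebraicTopology.FundamentalGroupoid.SimplyConnected
import HarnessLib

/-!
# Pieces of a boundary gluing: path connectivity, the bicollar of the seam, van Kampen
(helper file for item stmt-SmoothPoincare4-15219 `ContractibleHalvesOfSimplyConnectedSeam`,
route route-SmoothPoincare4-ConvexBisection)

For a boundary gluing `P = M ∪_φ N` of two null-cobordisms (compact smooth `(m+2)`-manifolds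
with boundary `cM.W`, `cN.W`, abstract boundaries `S ≅ ∂M`, `S' ≅ ∂N`), witnessed by
`G : BoundaryGluingData cM.boundaryData cN.boundaryData φ P` (smooth embeddings `jA`, `jB`
covering `P` and meeting exactly along the seam `jA(∂M) = jB(∂N)`), this file proves:

* `pathConnectedSpace_left` — if `P` is connected and `S` is path connected and nonempty, the
  piece `M` is path connected (a clopen subset of `M` missing `∂M` would have clopen image in `P`);
* `isStrongDeformationRetractOf_seam_bicollar` — the bicollar `jA(C_M) ∪ jB(C_N)` of the seam
  (`C = κ(∂ × [0, ε))` collar neighbourhoods) strongly deformation retracts onto the seam (the two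
  collar slides of Hatcher 2002, proof of Prop. 2.22, pasted along the seam);
* `simplyConnectedSpace_left` — **van Kampen, injectivity half**: if `P` is simply connected, the
  pieces are path connected and the seam is simply connected, then `M` is simply connected
  (free-product form `π₁(P) ≅ π₁(U) ∗ π₁(T)` on the open thickenings of the pieces,
  `Literature.AlgebraicTopology.FundamentalGroup.VanKampen.fundamentalGroupEquivCoprod`,
  Hatcher Thm. 1.20; `inl` is injective).

Everything for the second piece follows by `G.symm`.  Everything is proved; no definitions, no
named facts.

## References

* A. Hatcher, *Algebraic Topology*, CUP 2002, §1.2 Thm. 1.20, Props. 1.17–1.18; §2.1 Prop. 2.22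
  (proof). [HatcherAT2002]
-/

noncomputable section

-- the prescribed namespace `Summit.<P>.<Sub>.…` duplicates `SmoothPoincare4` (P = Sub)
set_option linter.dupNamespace false

open scoped Manifold ContDiff Topology unitInterval
open Set Function Topology
open Literature.Topology.FourManifolds
open Literature.AlgebraicTopology.FundamentalGroup
open Literature.AlgebraicTopology.FundamentalGroup.VanKampen
open Literature.AlgebraicTopology.Homotopy

namespace Summit.SmoothPoincare4.SmoothPoincare4.Theorems.ConvexBisection.ContractibleHalves

/-! ### One piece of a boundary gluing of two null-cobordisms -/

section Piece

variable {m : ℕ}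
variable {S : Type} [TopologicalSpace S] [ChartedSpace (EuclideanSpace ℝ (Fin (m + 1))) S]
  [IsManifold (𝓡 (m + 1)) ∞ S]
variable {S' : Type} [TopologicalSpace S'] [ChartedSpace (EuclideanSpace ℝ (Fin (m + 1))) S']
  [IsManifold (𝓡 (m + 1)) ∞ S']
variable {cM : NullCobordism (m + 1) S} {cN : NullCobordism (m + 1) S'} {φ : S ≃ S'}
variable {P : Type} [TopologicalSpace P] [ChartedSpace (EuclideanSpace ℝ (Fin (m + 1 + 1))) P]
  [IsManifold (𝓡 (m + 1 + 1)) ∞ P]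
variable (G : BoundaryGluingData cM.boundaryData cN.boundaryData φ P)

/-! #### The pieces are path connected -/

include G in
/-- **A piece of a boundary gluing of a connected manifold along a connected nonempty boundary
is path connected.**  Every nonempty clopen subset `C` of `M` meets `∂M`: otherwise `C ⊆ Int M`,
so `jA(C)` is open (equidimensional embeddings are open on interior points), closed (compact)
and nonempty in the connected `P`, whence `jA(C) = P` contains the seam point `jA (incl z₀)`
and `incl z₀ ∈ C ∩ ∂M` after all.  As `∂M = incl(S)` is connected, the path component of any
point (clopen: manifolds are locally path connected) contains `∂M`, so `M` is path connected.
[folklore] -/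
theorem pathConnectedSpace_left [PreconnectedSpace P] [Nonempty S] [PathConnectedSpace S] :
    PathConnectedSpace cM.W := by
  haveI : LocallyPathConnectedSpace cM.W :=
    ChartedSpace.locallyPathConnectedSpace (EuclideanHalfSpace (m + 1 + 1)) cM.W
  obtain ⟨z₀⟩ := (inferInstance : Nonempty S)
  -- `∂M` is path connected
  have hbd : IsPathConnected ((𝓡∂ (m + 1 + 1)).boundary cM.W) := by
    rw [← cM.range_incl]
    exact isPathConnected_range cM.continuous_incl
  -- every nonempty clopen set meets the boundary
  have key : ∀ C : Set cM.W, IsClopen C → C.Nonempty →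
      ∃ z : S, cM.incl z ∈ C := by
    intro C hC hCne
    by_contra hno
    have hno : ∀ z : S, cM.incl z ∉ C := fun z hz => hno ⟨z, hz⟩
    have hCint : C ⊆ (𝓡∂ (m + 1 + 1)).interior cM.W := by
      intro x hx
      rw [← ModelWithCorners.compl_boundary, mem_compl_iff, ← cM.range_incl]
      rintro ⟨z, rfl⟩
      exact hno z hx
    have hopen : IsOpen (G.jA '' C) :=
      isOpen_image_of_isSmoothEmbedding_of_subset_interior G.isSmoothEmbedding_jA hC.2 hCint
    have hclosed : IsClosed (G.jA '' C) := by
      rw [← G.isClosedEmbedding_jA.isClosed_iff_image_isClosed]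
      exact hC.1
    have huniv : G.jA '' C = univ := IsClopen.eq_univ ⟨hclosed, hopen⟩ (hCne.image _)
    have hx₀ : G.jA (cM.incl z₀) ∈ G.jA '' C := huniv.symm ▸ mem_univ _
    obtain ⟨x, hxC, hx⟩ := hx₀
    obtain rfl : x = cM.incl z₀ := G.injective_jA hx
    exact hno z₀ hxC
  -- the path component of any point contains the boundary point `incl z₀`
  refine ⟨⟨cM.incl z₀⟩, fun x y => ?_⟩
  have hx : Joined x (cM.incl z₀) := by
    obtain ⟨z, hz⟩ := key (pathComponent x) (IsClopen.pathComponent x) ⟨x, mem_pathComponent_self x⟩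
    exact (show Joined x (cM.incl z) from hz).trans
      ((hbd.joinedIn _ (cM.incl_mem_boundary z) _ (cM.incl_mem_boundary z₀)).joined)
  have hy : Joined y (cM.incl z₀) := by
    obtain ⟨z, hz⟩ := key (pathComponent y) (IsClopen.pathComponent y) ⟨y, mem_pathComponent_self y⟩
    exact (show Joined y (cM.incl z) from hz).trans
      ((hbd.joinedIn _ (cM.incl_mem_boundary z) _ (cM.incl_mem_boundary z₀)).joined)
  exact hx.trans hy.symm

/-! #### The bicollar of the seam deformation retracts onto the seam -/

omit [IsManifold (𝓡 (m + 1 + 1)) ∞ P] in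
/-- The trace of the bicollar `jA(C_M) ∪ jB(C_N)` on the second piece is `jB(C_N)` (`ε > 0`):
a point of `jA(C_M)` lying in `jB(N)` is a seam point `jB (incl w)`, and `∂N ⊆ C_N`. [folklore] -/
theorem bicollar_inter_range_jB (κM : cM.boundaryData.Collar) (κN : cN.boundaryData.Collar)
    {ε : ℝ} (hε : 0 < ε) {p : P}
    (hp : p ∈ G.jA '' cM.collarNhd κM ε ∪ G.jB '' cN.collarNhd κN ε) (hpB : p ∈ range G.jB) :
    p ∈ G.jB '' cN.collarNhd κN ε := by
  rcases hp with ⟨a, -, rfl⟩ | h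
  · obtain ⟨b, hb⟩ := hpB
    obtain ⟨z, -, rfl⟩ := (G.jA_eq_jB_iff a b).1 hb.symm
    exact ⟨_, cN.boundary_subset_collarNhd κN hε (cN.incl_mem_boundary (φ z)), hb⟩
  · exact h

omit [IsManifold (𝓡 (m + 1 + 1)) ∞ P] in
/-- The trace of the bicollar on the first piece is `jA(C_M)` (`ε > 0`). [folklore] -/
theorem bicollar_inter_range_jA (κM : cM.boundaryData.Collar) (κN : cN.boundaryData.Collar)
    {ε : ℝ} (hε : 0 < ε) {p : P}
    (hp : p ∈ G.jA '' cM.collarNhd κM ε ∪ G.jB '' cN.collarNhd κN ε) (hpA : p ∈ range G.jA) :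
    p ∈ G.jA '' cM.collarNhd κM ε := by
  rcases hp with h | ⟨b, -, rfl⟩
  · exact h
  · obtain ⟨a, ha⟩ := hpA
    obtain ⟨z, rfl, hb⟩ := (G.jA_eq_jB_iff a b).1 ha
    refine ⟨_, cM.boundary_subset_collarNhd κM hε (cM.incl_mem_boundary z), ?_⟩
    exact ha

/-- **The bicollar of the seam deformation retracts onto the seam.**  For collars `κM`, `κN` of
the two pieces and `ε > 0`, the bicollar `B = jA(C_M) ∪ jB(C_N)` of the seam
(`C = κ(∂ × [0, ε))`) strongly deformation retracts onto the seam `jA(∂M) = jB(∂N)`: slide down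
the collar lines of `M` on `jA(C_M)` and those of `N` on `jB(C_N)`; both slides fix the seam
pointwise, so the two prescriptions agree on `jA(C_M) ∩ jB(C_N) = seam` and paste along the
closed cover of `[0,1] × B` by the traces of the two (closed) pieces (Hatcher 2002, proof of
Prop. 2.22, run on both sides of the seam). [cite: HatcherAT2002, §2.1, Prop. 2.22 (proof)] -/
theorem isStrongDeformationRetractOf_seam_bicollar [Nonempty S] [Nonempty S']
    (κM : cM.boundaryData.Collar) (κN : cN.boundaryData.Collar) {ε : ℝ} (hε : 0 < ε) :
    IsStrongDeformationRetractOf G.seam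
      (G.jA '' cM.collarNhd κM ε ∪ G.jB '' cN.collarNhd κN ε) := by
  classical
  haveI : Nonempty cM.W := ⟨cM.incl (Classical.arbitrary S)⟩
  haveI : Nonempty cN.W := ⟨cN.incl (Classical.arbitrary S')⟩
  set B : Set P := G.jA '' cM.collarNhd κM ε ∪ G.jB '' cN.collarNhd κN ε with hB
  -- the two one-sided slides, as total functions on `[0,1] × P`
  set fA : unitInterval × P → P := fun q =>
    G.jA (κM ((cM.collarInv κM (G.invA q.2)).1,
      NullCobordism.slide q.1 (cM.collarInv κM (G.invA q.2)).2)) with hfA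
  set fB : unitInterval × P → P := fun q =>
    G.jB (κN ((cN.collarInv κN (G.invB q.2)).1,
      NullCobordism.slide q.1 (cN.collarInv κN (G.invB q.2)).2)) with hfB
  set f : unitInterval × P → P := fun q => if q.2 ∈ range G.jB then fB q else fA q with hf
  have hfA_jA : ∀ (s : unitInterval) {a : cM.W} (ha : a ∈ cM.collarNhd κM ε),
      fA (s, G.jA a) = G.jA (cM.collarSlide κM ε (s, ⟨a, ha⟩)) := fun s a ha => by
    simp only [hfA, NullCobordism.collarSlide_apply_coe, G.invA_jA]
  have hfB_jB : ∀ (s : unitInterval) {b : cN.W} (hb : b ∈ cN.collarNhd κN ε),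
      fB (s, G.jB b) = G.jB (cN.collarSlide κN ε (s, ⟨b, hb⟩)) := fun s b hb => by
    simp only [hfB, NullCobordism.collarSlide_apply_coe, G.invB_jB]
  -- both slides fix the seam
  have hfA_seam : ∀ (s : unitInterval) (z : S), fA (s, G.jA (cM.incl z)) = G.jA (cM.incl z) := by
    intro s z
    have hz : cM.incl z ∈ cM.collarNhd κM ε :=
      cM.boundary_subset_collarNhd κM hε (cM.incl_mem_boundary z)
    rw [hfA_jA s hz, cM.collarSlide_of_mem_boundary κM ε s ⟨_, hz⟩ (cM.incl_mem_boundary z)]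
  have hfB_seam : ∀ (s : unitInterval) (w : S'), fB (s, G.jB (cN.incl w)) = G.jB (cN.incl w) := by
    intro s w
    have hw : cN.incl w ∈ cN.collarNhd κN ε :=
      cN.boundary_subset_collarNhd κN hε (cN.incl_mem_boundary w)
    rw [hfB_jB s hw, cN.collarSlide_of_mem_boundary κN ε s ⟨_, hw⟩ (cN.incl_mem_boundary w)]
  -- on the trace of the first piece, `f = fA`
  have hf_A : ∀ (s : unitInterval) {p : P}, p ∈ B → p ∈ range G.jA → f (s, p) = fA (s, p) := by
    intro s p hp hpA
    by_cases hpB : p ∈ range G.jB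
    · -- a seam point
      obtain ⟨a, rfl⟩ := hpA
      obtain ⟨b, hb⟩ := id hpB
      obtain ⟨z, rfl, rfl⟩ := (G.jA_eq_jB_iff a b).1 hb.symm
      simp only [hf, if_pos hpB]
      show fB (s, G.jA (cM.incl z)) = fA (s, G.jA (cM.incl z))
      rw [hfA_seam, ← G.jB_incl_eq_jA_incl z, hfB_seam]
    · simp only [hf, if_neg hpB]
  have hf_B : ∀ (s : unitInterval) {p : P}, p ∈ range G.jB → f (s, p) = fB (s, p) :=
    fun s p hpB => by simp only [hf, if_pos hpB]
  -- values
  have hf_zero : ∀ {p : P}, p ∈ B → f (0, p) = p := by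
    intro p hp
    by_cases hpB : p ∈ range G.jB
    · obtain ⟨b, hb, rfl⟩ := bicollar_inter_range_jB G κM κN hε hp hpB
      rw [hf_B 0 hpB, hfB_jB 0 hb, cN.collarSlide_zero]
    · obtain ⟨a, ha, rfl⟩ : p ∈ G.jA '' cM.collarNhd κM ε :=
        hp.resolve_right fun h => hpB (image_subset_range _ _ h)
      rw [hf_A 0 hp (mem_range_self a), hfA_jA 0 ha, cM.collarSlide_zero]
  have hf_one : ∀ {p : P}, p ∈ B → f (1, p) ∈ G.seam := by
    intro p hp
    by_cases hpB : p ∈ range G.jB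
    · obtain ⟨b, hb, rfl⟩ := bicollar_inter_range_jB G κM κN hε hp hpB
      rw [hf_B 1 hpB, hfB_jB 1 hb, ← G.range_inter_range]
      exact ⟨G.mapsTo_jB_boundary (cN.collarSlide_one_mem κN ε ⟨b, hb⟩), mem_range_self _⟩
    · obtain ⟨a, ha, rfl⟩ : p ∈ G.jA '' cM.collarNhd κM ε :=
        hp.resolve_right fun h => hpB (image_subset_range _ _ h)
      have h1 : (cM.collarSlide κM ε (1, ⟨a, ha⟩) : cM.W) ∈ (𝓡∂ (m + 1 + 1)).boundary cM.W :=
        cM.collarSlide_one_mem κM ε ⟨a, ha⟩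
      rw [← cM.range_incl] at h1
      obtain ⟨z, hz⟩ := h1
      rw [hf_A 1 hp (mem_range_self a), hfA_jA 1 ha, ← hz]
      exact G.jA_incl_mem_seam z
  have hf_fix : ∀ (s : unitInterval) {p : P}, p ∈ G.seam → f (s, p) = p := by
    rintro s _ ⟨z, rfl⟩
    show f (s, G.jA (cM.incl z)) = G.jA (cM.incl z)
    rw [← G.jB_incl_eq_jA_incl z, hf_B s (mem_range_self _)]
    exact hfB_seam s (φ z)
  have hf_mem : ∀ (s : unitInterval) {p : P}, p ∈ B → f (s, p) ∈ B := by
    intro s p hp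
    by_cases hpB : p ∈ range G.jB
    · obtain ⟨b, hb, rfl⟩ := bicollar_inter_range_jB G κM κN hε hp hpB
      rw [hf_B s hpB, hfB_jB s hb]
      exact Or.inr ⟨_, (cN.collarSlide κN ε (s, ⟨b, hb⟩)).2, rfl⟩
    · obtain ⟨a, ha, rfl⟩ : p ∈ G.jA '' cM.collarNhd κM ε :=
        hp.resolve_right fun h => hpB (image_subset_range _ _ h)
      rw [hf_A s hp (mem_range_self a), hfA_jA s ha]
      exact Or.inl ⟨_, (cM.collarSlide κM ε (s, ⟨a, ha⟩)).2, rfl⟩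
  -- continuity, by pasting along the closed cover by the traces of the two pieces
  have hcont : Continuous fun q : unitInterval × ↥B => f (q.1, q.2.1) := by
    rw [← continuousOn_univ]
    set TA : Set (unitInterval × ↥B) := {q | (q.2 : P) ∈ range G.jA} with hTA
    set TB : Set (unitInterval × ↥B) := {q | (q.2 : P) ∈ range G.jB} with hTB
    have hval : Continuous fun q : unitInterval × ↥B => (q.2 : P) :=
      continuous_subtype_val.comp continuous_snd
    have hTAc : IsClosed TA := G.isClosed_range_jA.preimage hval
    have hTBc : IsClosed TB := G.isClosed_range_jB.preimage hval
    have hcov : TA ∪ TB = univ := eq_univ_of_forall fun q =>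
      (G.range_union.symm.subset (mem_univ (q.2 : P))).imp id id
    rw [← hcov]
    refine ContinuousOn.union_of_isClosed ?_ ?_ hTAc hTBc
    · -- on the first piece: `f = fA`, continuous through `invA` and `collarInv κM`
      have hinvA : ContinuousOn (fun q : unitInterval × ↥B => G.invA (q.2 : P)) TA :=
        G.continuousOn_invA.comp hval.continuousOn fun q hq => hq
      have hrange : ∀ q ∈ TA, G.invA (q.2 : P) ∈ range κM := fun q hq => by
        obtain ⟨a, ha, haq⟩ := bicollar_inter_range_jA G κM κN hε q.2.2 hq
        rw [← haq, G.invA_jA]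
        exact cM.collarNhd_subset_range κM ε ha
      have hcinv : ContinuousOn
          (fun q : unitInterval × ↥B => cM.collarInv κM (G.invA (q.2 : P))) TA :=
        (cM.continuousOn_collarInv κM).comp hinvA hrange
      have hg : ContinuousOn (fun q : unitInterval × ↥B => fA (q.1, (q.2 : P))) TA := by
        refine G.continuous_jA.comp_continuousOn (κM.continuous.comp_continuousOn ?_)
        refine (continuous_fst.comp_continuousOn hcinv).prodMk ?_
        exact NullCobordism.continuous_slide.comp_continuousOn
          (continuous_fst.continuousOn.prodMk (continuous_snd.comp_continuousOn hcinv))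
      exact hg.congr fun q hq => hf_A q.1 q.2.2 hq
    · have hinvB : ContinuousOn (fun q : unitInterval × ↥B => G.invB (q.2 : P)) TB :=
        G.continuousOn_invB.comp hval.continuousOn fun q hq => hq
      have hrange : ∀ q ∈ TB, G.invB (q.2 : P) ∈ range κN := fun q hq => by
        obtain ⟨b, hb, hbq⟩ := bicollar_inter_range_jB G κM κN hε q.2.2 hq
        rw [← hbq, G.invB_jB]
        exact cN.collarNhd_subset_range κN ε hb
      have hcinv : ContinuousOn
          (fun q : unitInterval × ↥B => cN.collarInv κN (G.invB (q.2 : P))) TB :=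
        (cN.continuousOn_collarInv κN).comp hinvB hrange
      have hg : ContinuousOn (fun q : unitInterval × ↥B => fB (q.1, (q.2 : P))) TB := by
        refine G.continuous_jB.comp_continuousOn (κN.continuous.comp_continuousOn ?_)
        refine (continuous_fst.comp_continuousOn hcinv).prodMk ?_
        exact NullCobordism.continuous_slide.comp_continuousOn
          (continuous_fst.continuousOn.prodMk (continuous_snd.comp_continuousOn hcinv))
      exact hg.congr fun q hq => hf_B q.1 hq
  exact ⟨⟨fun q => ⟨f (q.1, q.2.1), hf_mem q.1 q.2.2⟩, hcont.subtype_mk _⟩,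
    fun x => Subtype.ext (hf_zero x.2), fun x => hf_one x.2,
    fun s x hx => Subtype.ext (hf_fix s hx)⟩

/-! #### The pieces are simply connected -/

omit [IsManifold (𝓡 (m + 1 + 1)) ∞ P] in
/-- `IsSimplyConnected univ` is `SimplyConnectedSpace`. [folklore] -/
theorem isSimplyConnected_univ_iff {X : Type*} [TopologicalSpace X] :
    IsSimplyConnected (univ : Set X) ↔ SimplyConnectedSpace X :=
  (Homeomorph.Set.univ X).toHomotopyEquiv.simplyConnectedSpace_iff

include G in
/-- **Van Kampen, injectivity half, for a boundary gluing with simply connected seam**: if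
`P = M ∪_φ N` is simply connected, both pieces are path connected and the seam `jA(∂M)` is simply
connected, then the first piece `M` is simply connected.  With collars of the two boundaries, the
open thickenings `U = jA M ∪ jB(C_N)`, `T = jB N ∪ jA(C_M)` cover `P`, deformation retract onto
the pieces (`BoundaryGluingData.exists_deformation_thickening`), and meet in the bicollar
`jA(C_M) ∪ jB(C_N)`, which deformation retracts onto the seam and is therefore simply connected;
van Kampen in free-product form (`VanKampen.fundamentalGroupEquivCoprod`, Hatcher Thm. 1.20)
gives `1 = π₁(P) ≅ π₁(U) ∗ π₁(T)`, so `π₁(U) = 1` (`inl` is injective), `π₁(jA M) = 1`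
(Prop. 1.17) and `π₁(M) = 1` (Prop. 1.18).
[cite: HatcherAT2002, Thm. 1.20, Prop. 1.17, Prop. 1.18] -/
theorem simplyConnectedSpace_left [CompactSpace S] [T2Space S] [Nonempty S]
    [CompactSpace S'] [T2Space S'] [Nonempty S'] [SimplyConnectedSpace P]
    [PathConnectedSpace cM.W] [PathConnectedSpace cN.W] (hseam : IsSimplyConnected G.seam) :
    SimplyConnectedSpace cM.W := by
  -- collars and the open thickenings `U = jA M ∪ jB(C₁)`, `T = jB N ∪ jA(C₁)`
  obtain ⟨κN⟩ := BoundaryData.nonempty_collar_of_compactSpace m cN.W cN.boundaryData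
  obtain ⟨κM⟩ := BoundaryData.nonempty_collar_of_compactSpace m cM.W cM.boundaryData
  obtain ⟨z₀⟩ := (inferInstance : Nonempty S)
  set x₀ : P := G.jA (cM.incl z₀) with hx₀
  have hx₀B : G.jB (cN.incl (φ z₀)) = x₀ := G.jB_incl_eq_jA_incl z₀
  set U : Set P := range G.jA ∪ G.jB '' cN.collarNhd κN 1 with hU
  set T : Set P := range G.jB ∪ G.jA '' cM.collarNhd κM 1 with hT
  have hUo : IsOpen U := G.isOpen_thickening κN one_pos le_rfl
  have hTo : IsOpen T := G.symm.isOpen_thickening κM one_pos le_rfl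
  have hcov : U ∪ T = univ := by
    apply eq_univ_of_univ_subset
    rw [← G.range_union]
    exact union_subset_union subset_union_left subset_union_left
  have hxA : x₀ ∈ range G.jA := mem_range_self _
  have hxB : x₀ ∈ range G.jB := ⟨_, hx₀B⟩
  have hxU : x₀ ∈ U := Or.inl hxA
  have hxT : x₀ ∈ T := Or.inl hxB
  -- the thickenings deformation retract onto the pieces, hence are path connected
  obtain ⟨HU, hU0, hU1, hUfix⟩ := G.exists_deformation_thickening κN one_pos
  have hdefU : IsStrongDeformationRetractOf (range G.jA) U := ⟨HU, hU0, hU1, hUfix⟩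
  have hdefT : IsStrongDeformationRetractOf (range G.jB) T := by
    obtain ⟨H, h0, h1, hfix⟩ := G.symm.exists_deformation_thickening κM one_pos
    exact ⟨H, h0, h1, hfix⟩
  have hApc : IsPathConnected (range G.jA) := isPathConnected_range G.continuous_jA
  have hBpc : IsPathConnected (range G.jB) := isPathConnected_range G.continuous_jB
  have hUpc : IsPathConnected U :=
    hdefU.isPathConnected (by rwa [inter_eq_left.2 (subset_union_left : range G.jA ⊆ U)])
  have hTpc : IsPathConnected T :=
    hdefT.isPathConnected (by rwa [inter_eq_left.2 (subset_union_left : range G.jB ⊆ T)])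
  -- `U ∩ T` is the bicollar of the seam, which deformation retracts onto the seam
  have hmeet_eq : U ∩ T = G.jA '' cM.collarNhd κM 1 ∪ G.jB '' cN.collarNhd κN 1 := by
    apply Subset.antisymm
    · rintro p ⟨hpU, hpT⟩
      rcases hpT with hpB | hpCM
      · rcases hpU with hpA | hpCN
        · left
          obtain ⟨a, rfl⟩ := hpA
          obtain ⟨z, rfl⟩ := (G.jA_mem_seam_iff a).1
            (by rw [← G.range_inter_range]; exact ⟨mem_range_self a, hpB⟩)
          exact ⟨_, cM.boundary_subset_collarNhd κM one_pos (cM.incl_mem_boundary z), rfl⟩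
        · exact Or.inr hpCN
      · exact Or.inl hpCM
    · rintro p (hp | hp)
      · exact ⟨Or.inl (image_subset_range _ _ hp), Or.inr hp⟩
      · exact ⟨Or.inr hp, Or.inl (image_subset_range _ _ hp)⟩
  have hsc : IsSimplyConnected (U ∩ T) := by
    rw [hmeet_eq]
    obtain ⟨H, h0, h1, hfix⟩ := isStrongDeformationRetractOf_seam_bicollar G κM κN one_pos
    have hsub : G.seam ⊆ G.jA '' cM.collarNhd κM 1 ∪ G.jB '' cN.collarNhd κN 1 := by
      rintro _ ⟨z, rfl⟩
      exact Or.inl ⟨_, cM.boundary_subset_collarNhd κM one_pos (cM.incl_mem_boundary z), rfl⟩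
    exact (isSimplyConnected_iff_of_deformation hsub H h0 h1 hfix).2 hseam
  -- van Kampen, free-product form: `π₁(P, x₀) ≅ π₁(U, x₀) ∗ π₁(T, x₀)` with trivial left side
  haveI : Subsingleton (FundamentalGroup ↥U ⟨x₀, hxU⟩) := by
    refine ⟨fun a b => Monoid.Coprod.inl_injective (N := FundamentalGroup ↥T ⟨x₀, hxT⟩) ?_⟩
    rw [← fundamentalGroupEquivCoprod_inclHom_left hUo hTo hcov hxU hxT hUpc hTpc hsc a,
      ← fundamentalGroupEquivCoprod_inclHom_left hUo hTo hcov hxU hxT hUpc hTpc hsc b,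
      Subsingleton.elim (inclHom U x₀ hxU a) (inclHom U x₀ hxU b)]
  have hUsc : IsSimplyConnected U := by
    haveI : PathConnectedSpace ↥U := isPathConnected_iff_pathConnectedSpace.1 hUpc
    exact simplyConnectedSpace_of_loops_nullhomotopic_at (⟨x₀, hxU⟩ : ↥U) fun γ =>
      Path.Homotopic.Quotient.eq.mp (Subsingleton.elim (α := FundamentalGroup ↥U ⟨x₀, hxU⟩)
        (Path.Homotopic.Quotient.mk γ) (Path.Homotopic.Quotient.mk (Path.refl _)))
  -- back to `jA M` (deformation retract) and to `M` (homeomorphism)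
  have hAsc : IsSimplyConnected (range G.jA) :=
    (isSimplyConnected_iff_of_deformation (subset_union_left : range G.jA ⊆ U)
      HU hU0 hU1 hUfix).1 hUsc
  rw [← image_univ, G.isSmoothEmbedding_jA.isEmbedding.isSimplyConnected_image,
    isSimplyConnected_univ_iff] at hAsc
  exact hAsc

end Piece

end Summit.SmoothPoincare4.SmoothPoincare4.Theorems.ConvexBisection.ContractibleHalves

end
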